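import Mathlib

/-!
# The Córdoba–Fefferman displacement PRICE of a floor step (pub-fluidc cell, rung R2, card O6)
(mathematics and Lean by seat idea-2 gen 5, `HOME/pub-fluidc-idea-2/SKETCH-R2-material.lean`
sha16 411924c9…; landed DEF-FREE by seat p2 gen 2: the card's predicates `CFWindowInequality`,
`WindowMono`, `DisplacementBudget`, `KelvinGain` appear UNFOLDED as hypotheses of the theorems, and
the per-row atlas columns of §4 (`floorPrice`, `affordability`, `minClock`, `KelvinAffordable`) stay
in the seat files / `scan_material.py` — no definition is introduced in the tree. The analytic
input — the window inequality for measure-preserving flows and the FGT displacement budget along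
classical Navier–Stokes solutions on `T³` — is PROVED in the sibling file
`Summits/NavierStokesRegularity/FluidComputer/MaterialDisplacement.lean`.)

HONEST FRAMING: low prior, high value-of-information experiment on Tao's machine paradigm;
NOT a claim that NS blows up.

Proved SUPPORT ARITHMETIC only (no `sorry`, no axioms, no definitions; the physical dictionary
— materiality of the carrier, Kelvin/Helmholtz, uniform cross-section over the window — enters as
HYPOTHESES, never as assertions).  Printed sources (cited as printed, locators in
CARD-O6-material-price.md): Córdoba–Fefferman 2001 [CordobaFefferman2001, CMP 222, Theorem §3 and
§5 eqs. (29)–(34)]; D. Córdoba 2006 survey [Appl. Math. 51, 299–320, Thm 2.1 and (2.6),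
doi:10.1007/s10778-006-0108-x]; Córdoba–Fefferman–de la Llave 2004 [SIAM J. Math. Anal. 36,
204–213, doi:10.1137/s0036141003424095]; Foias–Guillopé–Temam 1981 [FoiasGuillopeTemam1981] =
IN TREE `Literature.Analysis.FluidPDE.norm_le_fgtSupBound`, `fgtSupPrimitive_sub_le`
(`Literature/Analysis/FluidPDE/ExtremeGrowthSupNormAPriori.lean`, unit torus, classical solutions,
explicit constants `fgtRateCoeff ν = √2/(4πν)`, `fgtConstCoeff = 3√2/(4π)`,
`fgtGradCoeff ν = √2·27/(16π⁵ν⁴) + 3√2/(4π)`).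

Dictionary to the R2 atlas (SCHEMA 9.21): `D` = per-step sup-displacement
`∫_{t_start}^{t_peak} umax dt` (diag.jsonl `umax`), `w` = the family's coherent window length
(PREREG-NEG-R2-G5 §1 table, frozen before the scan), `lam` = band ratio λ, `g` = band sup-velocity
gain, `q` = cross-section contraction of the carrier over the window.
-/

namespace Summit.NavierStokesRegularity.FluidComputer.MaterialPrice

open Finset

/-! ## 1. The Córdoba–Fefferman window inequality and non-collapse from a displacement budget -/

/-- **NON-COLLAPSE FROM A BUDGET** (CF 2001's theorem, quantitative form; Córdoba 2006 (2.6)).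
Hypotheses, in the card's vocabulary (stated unfolded): `hcf` = the **CF WINDOW INEQUALITY**
[CordobaFefferman2001, §5 (29)–(34)] — `V t a b` = volume of the (material) tube at time `t` inside
the lab-frame axial window `a ≤ x₃ ≤ b`, `D t₁ t₂` = sup-displacement `∫_{t₁}^{t₂} sup_x |u| dt`,
and `V t₁ (a + D) (b − D) ≤ V t₂ a b` (proved for measure-preserving flows in
`MaterialDisplacement.cfWindowInequality_of_flow`); `hmono` = sub-windows hold less volume;
`hbud` = the **DISPLACEMENT BUDGET** `D t₀ t ≤ B` on `[t₀, T)` (for Navier–Stokes on `T³`: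
Foias–Guillopé–Temam 1981, `MaterialDisplacement.displacementBudget_fgt`, explicit
`B = fgtRateCoeff ν + fgtConstCoeff·(T − t₀) + fgtGradCoeff ν/ν · K(u t₀)`); `hD` = `D ≥ 0`.
Conclusion: if the budget is less than half the window and the tube holds volume `≥ m` on the
inner window `[a + B, b − B]` at time `t₀`, then its volume on `[a, b]` never drops below `m`
before `T` — a regular MATERIAL tube cannot collapse on `T³`, with an explicit floor.
Pure order reasoning. [CordobaFefferman2001, §5; Córdoba 2006, Appl. Math. 51, (2.6)] -/
theorem volume_ge_of_budget {V : ℝ → ℝ → ℝ → ℝ} {D : ℝ → ℝ → ℝ} {t₀ T B a b m : ℝ}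
    (hcf : ∀ t₁ t₂ a b : ℝ, t₁ ≤ t₂ → a + 2 * D t₁ t₂ ≤ b →
      V t₁ (a + D t₁ t₂) (b - D t₁ t₂) ≤ V t₂ a b)
    (hmono : ∀ t a b a' b' : ℝ, a ≤ a' → b' ≤ b → V t a' b' ≤ V t a b)
    (hbud : ∀ t : ℝ, t₀ ≤ t → t < T → D t₀ t ≤ B)
    (hD : ∀ t : ℝ, t₀ ≤ t → 0 ≤ D t₀ t) (hB : a + 2 * B ≤ b)
    (hm : m ≤ V t₀ (a + B) (b - B)) :
    ∀ t : ℝ, t₀ ≤ t → t < T → m ≤ V t a b := by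
  intro t ht htT
  have h1 : D t₀ t ≤ B := hbud t ht htT
  have h0 : 0 ≤ D t₀ t := hD t ht
  have hwin : a + 2 * D t₀ t ≤ b := by linarith
  have h2 : V t₀ (a + D t₀ t) (b - D t₀ t) ≤ V t a b := hcf t₀ t a b ht hwin
  have h3 : V t₀ (a + B) (b - B) ≤ V t₀ (a + D t₀ t) (b - D t₀ t) :=
    hmono t₀ (a + D t₀ t) (b - D t₀ t) (a + B) (b - B) (by linarith) (by linarith)
  linarith

/-! ## 2. The price of a contraction and of a floor step -/

/-- **UNIFORM-TUBE CONTRACTION PRICE**: if the cross-section is uniform along the window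
(`V t a b = A t · w`, `w = b − a`; PREREG §1 states the uniformity caveat per family), the CF
inequality `A₁ (w − 2D) ≤ A₂ w` prices a whole-window contraction `q = A₂/A₁` at
`D ≥ (1 − q) w / 2`.  Proved. -/
theorem contraction_price {A₁ A₂ w D : ℝ} (hw : 0 < w) (hA₁ : 0 < A₁)
    (hcf : A₁ * (w - 2 * D) ≤ A₂ * w) : (1 - A₂ / A₁) * w / 2 ≤ D := by
  have key : (1 - A₂ / A₁) * w / 2 = (A₁ * w - A₂ * w) / (2 * A₁) := by
    field_simp
  rw [key, div_le_iff₀ (by positivity)]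
  nlinarith

/-- **FLOOR-STEP PRICE**: a circulation-conserving whole-window contraction delivering `g ≥ λ > 1`
costs sup-displacement `D ≥ (λ² − 1) w / (2 λ²)` (= `3w/8` at λ = 2, `0.4375 w` at 2.83,
`0.46875 w` at 4). Hypothesis `hK : g² q = 1` is the **KELVIN READING** of the card (dictionary
hypothesis — Euler/Helmholtz: the carrier is a material vortex tube, its circulation is conserved,
the band sup-velocity is `U ≈ c·Γ/radius` with the same shape factor before and after, so the
amplitude gain of a contraction `q = A₂/A₁` is `g = q^{-1/2}`; a pure Kelvin step sits EXACTLY on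
the R2 floor line `r = g/λ = 1` — card O2's / `CirculationLedger`'s endpoint, priced here).
Proved from the contraction price and the Kelvin reading. -/
theorem floor_step_price {q g lam w D : ℝ} (hlam : 1 < lam) (hq : 0 < q) (hw : 0 < w)
    (hK : g ^ 2 * q = 1) (hg : lam ≤ g) (hprice : (1 - q) * w / 2 ≤ D) :
    (lam ^ 2 - 1) * w / (2 * lam ^ 2) ≤ D := by
  have hl0 : 0 < lam := lt_trans zero_lt_one hlam
  have h1 : lam ^ 2 ≤ g ^ 2 := by nlinarith
  have h2 : q * lam ^ 2 ≤ 1 := by nlinarith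
  have hA : q * lam ^ 2 * w ≤ w := by nlinarith
  have hB : lam ^ 2 * ((1 - q) * w) ≤ lam ^ 2 * (2 * D) :=
    mul_le_mul_of_nonneg_left (by linarith) (by positivity)
  rw [div_le_iff₀ (by positivity)]
  nlinarith

/-! ## 3. Along a cascade: summable windows, finite depth for a fixed window -/

/-- **SUMMABLE WINDOWS** (CF price + one displacement budget along a cascade of whole-window floor
steps): if level `n` costs `(λ² − 1) w n / (2λ²) ≤ D n` and `∑_{n<N} D n ≤ B`, then
`∑_{n<N} w n ≤ 2 λ² B / (λ² − 1)`.  With FGT's `B < ∞` for NS: the carriers' windows are summable —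
a MATERIAL floor cascade must localise along the vortex axis as well (collapse toward points,
never onto a segment: CF 2001 for NS).  Proved. -/
theorem windows_sum_le {lam B : ℝ} {w D : ℕ → ℝ} (hlam : 1 < lam) (N : ℕ)
    (hprice : ∀ n, (lam ^ 2 - 1) * w n / (2 * lam ^ 2) ≤ D n)
    (hbud : ∑ n ∈ range N, D n ≤ B) :
    ∑ n ∈ range N, w n ≤ 2 * lam ^ 2 * B / (lam ^ 2 - 1) := by
  have hl0 : 0 < lam := lt_trans zero_lt_one hlam
  have hl2 : 0 < lam ^ 2 - 1 := by nlinarith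
  have hsum : ∑ n ∈ range N, (lam ^ 2 - 1) * w n / (2 * lam ^ 2) ≤ ∑ n ∈ range N, D n :=
    sum_le_sum fun n _ => hprice n
  have hfac : ∑ n ∈ range N, (lam ^ 2 - 1) * w n / (2 * lam ^ 2) =
      (lam ^ 2 - 1) / (2 * lam ^ 2) * ∑ n ∈ range N, w n := by
    rw [mul_sum]
    refine sum_congr rfl fun n _ => ?_
    ring
  rw [hfac] at hsum
  rw [le_div_iff₀ hl2]
  have h3 : (lam ^ 2 - 1) / (2 * lam ^ 2) * ∑ n ∈ range N, w n ≤ B := le_trans hsum hbud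
  have h4 : (lam ^ 2 - 1) / (2 * lam ^ 2) * (2 * lam ^ 2) = lam ^ 2 - 1 := by
    field_simp
  have h5 : (∑ n ∈ range N, w n) * (lam ^ 2 - 1) =
      ((lam ^ 2 - 1) / (2 * lam ^ 2) * ∑ n ∈ range N, w n) * (2 * lam ^ 2) := by
    have e : ((lam ^ 2 - 1) / (2 * lam ^ 2) * ∑ n ∈ range N, w n) * (2 * lam ^ 2) =
        (∑ n ∈ range N, w n) * ((lam ^ 2 - 1) / (2 * lam ^ 2) * (2 * lam ^ 2)) := by ring
    rw [e, h4]
  rw [h5]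
  have h6 := mul_le_mul_of_nonneg_right h3 (by positivity : (0:ℝ) ≤ 2 * lam ^ 2)
  linarith

/-- **FIXED-WINDOW DEPTH BOUND**: ONE coherent structure of window `w₀ > 0` (a box-spanning tube,
a ring of fixed circumference, a sheet of fixed extent) can take at most
`N ≤ 2 λ² B / ((λ² − 1) w₀)` whole-window floor steps out of a budget `B`: depth via one
persistent material structure is finite (at DNS parameters `B` = the run's measured
`∫ umax dt`).  Proved. -/
theorem levels_le_of_fixed_window {lam B w₀ : ℝ} {D : ℕ → ℝ} (hlam : 1 < lam) (hw : 0 < w₀)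
    (N : ℕ) (hprice : ∀ n, (lam ^ 2 - 1) * w₀ / (2 * lam ^ 2) ≤ D n)
    (hbud : ∑ n ∈ range N, D n ≤ B) :
    (N : ℝ) ≤ 2 * lam ^ 2 * B / ((lam ^ 2 - 1) * w₀) := by
  have hl0 : 0 < lam := lt_trans zero_lt_one hlam
  have hl2 : 0 < lam ^ 2 - 1 := by nlinarith
  have h1 : ∑ n ∈ range N, (lam ^ 2 - 1) * w₀ / (2 * lam ^ 2) ≤ ∑ n ∈ range N, D n :=
    sum_le_sum fun n _ => hprice n
  simp only [sum_const, card_range, nsmul_eq_mul] at h1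
  have h2 : (N : ℝ) * ((lam ^ 2 - 1) * w₀ / (2 * lam ^ 2)) ≤ B := le_trans h1 hbud
  rw [le_div_iff₀ (by positivity)]
  have h4 : (lam ^ 2 - 1) * w₀ / (2 * lam ^ 2) * (2 * lam ^ 2) = (lam ^ 2 - 1) * w₀ := by
    field_simp
  have h5 : (N : ℝ) * ((lam ^ 2 - 1) * w₀) =
      ((N : ℝ) * ((lam ^ 2 - 1) * w₀ / (2 * lam ^ 2))) * (2 * lam ^ 2) := by
    have e : ((N : ℝ) * ((lam ^ 2 - 1) * w₀ / (2 * lam ^ 2))) * (2 * lam ^ 2) =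
        (N : ℝ) * ((lam ^ 2 - 1) * w₀ / (2 * lam ^ 2) * (2 * lam ^ 2)) := by ring
    rw [e, h4]
  rw [h5]
  have h6 := mul_le_mul_of_nonneg_right h2 (by positivity : (0:ℝ) ≤ 2 * lam ^ 2)
  linarith

end Summit.NavierStokesRegularity.FluidComputer.MaterialPrice
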